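import Summits.QuantumFields.YangMills.Theorems.LuscherReductionTwistedTraceScalingBTFibreProfile
import Summits.QuantumFields.YangMills.Theorems.LuscherReductionTwistedTraceScalingBTHaarFloor
import Summits.QuantumFields.YangMills.Theorems.LuscherReductionTwistedTraceScalingBOCentralTube
import HarnessLib

/-!
# A POLYNOMIAL SMALL-BALL FLOOR for the fibre measure `π = orthoTransverse` and for the inner Gaussian fibre mass
# (lane A of S-BASE, crux `TwistedTraceScaling` stmt-QuantumFields-20203, C4-CORE, the (OD) pen; `pub/ym-fleet/ym-luscher-20007-p1/HANDOFF-g19.md` step (4))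

The (B-OD) constant `b` compares the fibre mass of the profile over the WHOLE support ball `‖x‖ ≤ r_f` (`recordGamma`) with the mass over the INNER core `‖x‖ ≤ r_f/12`
where the central quasimode holds; the shell carries `e^{-cℓ²}` pointwise, so what is needed is a POLYNOMIAL floor for the inner mass.  `…BTFibreProfile.orthoTransverse_ball_pos`
gives positivity only; here is the quantitative version, by the same coverage argument (`mem_orthoTubeSet_of_near_one`) and the Haar floor `haarReal_quatBall_ge`:
* `one_sub_scalarPart_le_norm_sub_one` — `1 − (A)₀ ≤ ‖q(A) − 1‖`;
* `configMeasure_real_nearBox_ge` — `μ{U : ∀ e, 1 − δ ≤ (U_e)₀} ≥ (δ³/10)^{|E|}` (`0 < δ ≤ 1`; the box contains `quatBall(δ)^{E}`);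
* ★★ `orthoTransverse_real_ball_ge` — `π{‖linkEmbed v‖ < ρ} ≥ (δ³/10)^{|E|}`, `δ = min(1/50, ρ²/(20|E|))`, every `ρ > 0`;
* ★ `inner_gauss_mass_ge` — `∫ 𝟙_{‖x‖≤R} e^{−2q_{t,b}(x)}e^{−‖P_Γx‖²/s²} dπ ≥ e^{−(2(96t+b)+1/s²)ρ²}·π{‖linkEmbed v‖ < ρ}` for `ρ ≤ R` (`q ≤ (96t+b)‖x‖²`, `‖P_Γx‖ ≤ ‖x‖`).
With `ρ = β^{-1}`, `t = β/2`, `b = β`, `s = β^{-1}`: the exponent is `99`, and the floor is `β^{-6|E|}` up to constants — polynomial, as (C5) needs against `e^{-cℓ²}`.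
HONEST FRAMING: a measure-theoretic floor for a stub of a child of the CONDITIONAL route R2b1; (C5), the final `b`, (B-ST), C4-CORE OPEN; not a gap, not Clay.
-/

set_option autoImplicit false

noncomputable section

open MeasureTheory Filter Topology Real
open scoped BigOperators
open Literature.MathematicalPhysics.QuantumFieldTheory
open Literature.MathematicalPhysics.QuantumLattice

namespace Summit.QuantumFields.YangMills.Theorems.FemtoTransferGap.TwoLattice.ConstTube

open Summit.QuantumFields.YangMills.Theorems.FemtoTransferGap
open Summit.QuantumFields.YangMills.Theorems.FemtoTransferGap.TwoLattice
open Summit.QuantumFields.YangMills.Theorems.FemtoTransferGap.TwoLattice.Avg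
open Summit.QuantumFields.YangMills.Theorems.FemtoTransferGap.TwoLattice.SlowChart
open Summit.QuantumFields.YangMills.Theorems.FemtoTransferGap.TwoLattice.Stiff

variable {L : ℕ} [NeZero L]

/-! ## §1 Scalar part against the quaternion distance -/

omit [NeZero L] in
/-- `1 − (A)₀ ≤ ‖q(A) − 1‖`. [folklore] -/
theorem one_sub_scalarPart_le_norm_sub_one (A : SU2) : 1 - scalarPart A ≤ ‖su2Quat A - 1‖ := by
  have hre : (su2Quat A).re = scalarPart A := rfl
  have h : ‖su2Quat A - 1‖ ^ 2 = ((su2Quat A).re - 1) ^ 2 + (su2Quat A).imI ^ 2 + (su2Quat A).imJ ^ 2 + (su2Quat A).imK ^ 2 := by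
    rw [sq, ← Quaternion.normSq_eq_norm_mul_self, Quaternion.normSq_def']
    simp only [Quaternion.re_sub, Quaternion.imI_sub, Quaternion.imJ_sub, Quaternion.imK_sub, Quaternion.re_one, Quaternion.imI_one, Quaternion.imJ_one,
      Quaternion.imK_one, sub_zero]
  have hn := norm_nonneg (su2Quat A - 1)
  have h1 : |(su2Quat A).re - 1| ≤ ‖su2Quat A - 1‖ :=
    abs_le_of_sq_le_sq' (by nlinarith [sq_nonneg (su2Quat A).imI, sq_nonneg (su2Quat A).imJ, sq_nonneg (su2Quat A).imK]) hn |> fun h => abs_le.mpr h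
  rw [← hre]
  linarith [(abs_le.mp h1).1]

/-! ## §2 The product-Haar floor of the near-vacuum box -/

/-- **`μ{U : ∀ e, 1 − δ ≤ (U_e)₀} ≥ (δ³/10)^{|E|}`** for `0 < δ ≤ 1` (the box contains `quatBall(δ)^{Edge}`, whose product Haar mass is `Haar(quatBall δ)^{|E|}`). [folklore] -/
theorem configMeasure_real_nearBox_ge {δ : ℝ} (hδ : 0 < δ) (hδ1 : δ ≤ 1) :
    (δ ^ 3 / 10) ^ Fintype.card (Edge 3 L) ≤ (configMeasure SU2 L).real {U : GaugeConfig 3 L SU2 | ∀ e : Edge 3 L, 1 - δ ≤ scalarPart (U e)} := by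
  have hsub : (Set.pi Set.univ fun _ : Edge 3 L => quatBall δ) ⊆ {U : GaugeConfig 3 L SU2 | ∀ e : Edge 3 L, 1 - δ ≤ scalarPart (U e)} := by
    intro U hU e
    have he : U e ∈ quatBall δ := hU e (Set.mem_univ _)
    have h1 := one_sub_scalarPart_le_norm_sub_one (U e)
    have h2 : ‖su2Quat (U e) - 1‖ ≤ δ := he
    linarith
  have hbox : (configMeasure SU2 L).real (Set.pi Set.univ fun _ : Edge 3 L => quatBall δ) = (haarProbability SU2).real (quatBall δ) ^ Fintype.card (Edge 3 L) := by
    rw [measureReal_def, configMeasure, Measure.pi_pi, Finset.prod_const, Finset.card_univ, ENNReal.toReal_pow, measureReal_def]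
  calc (δ ^ 3 / 10) ^ Fintype.card (Edge 3 L) ≤ (haarProbability SU2).real (quatBall δ) ^ Fintype.card (Edge 3 L) :=
        pow_le_pow_left₀ (by positivity) (haarReal_quatBall_ge hδ hδ1) _
    _ = (configMeasure SU2 L).real (Set.pi Set.univ fun _ : Edge 3 L => quatBall δ) := hbox.symm
    _ ≤ (configMeasure SU2 L).real {U : GaugeConfig 3 L SU2 | ∀ e : Edge 3 L, 1 - δ ≤ scalarPart (U e)} := measureReal_mono hsub

/-! ## §3 ★★ The polynomial floor of the fibre measure of a ball -/

/-- ★★ **`π{‖linkEmbed v‖ < ρ} ≥ (δ³/10)^{|E|}`, `δ = min(1/50, ρ²/(20|E|))`**, for every `ρ > 0`: every configuration of the near-vacuum box `{∀ e, (U_e)₀ ≥ 1 − δ}` is an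
orthographic tube point with `‖x‖² ≤ 10δ|E| < ρ²` (`mem_orthoTubeSet_of_near_one`). [folklore] -/
theorem orthoTransverse_real_ball_ge {ρ : ℝ} (hρ : 0 < ρ) :
    ((min (1 / 50) (ρ ^ 2 / (20 * Fintype.card (Edge 3 L)))) ^ 3 / 10) ^ Fintype.card (Edge 3 L) ≤ (orthoTransverse L).real {v | ‖linkEmbed L v‖ < ρ} := by
  haveI : PolishSpace (capBalancedSet L) := (isClosed_capBalancedSet L).polishSpace
  haveI := isFiniteMeasure_orthoTransverse L
  have hA : MeasurableSet {v : Edge 3 L → Fin 3 → ℝ | ‖linkEmbed L v‖ < ρ} :=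
    measurableSet_lt ((measurable_linkEmbed L).norm) measurable_const
  have hE : (0 : ℝ) < Fintype.card (Edge 3 L) := by exact_mod_cast Fintype.card_pos
  set δ : ℝ := min (1 / 50) (ρ ^ 2 / (20 * Fintype.card (Edge 3 L))) with hδ
  have hδ0 : 0 < δ := lt_min (by norm_num) (by positivity)
  have hδ50 : δ ≤ 1 / 50 := min_le_left _ _
  have hδρ : δ ≤ ρ ^ 2 / (20 * Fintype.card (Edge 3 L)) := min_le_right _ _
  set O : Set (GaugeConfig 3 L SU2) := {U | ∀ e : Edge 3 L, 1 - δ ≤ scalarPart (U e)} with hO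
  have hsub : O ⊆ slowEmb (orthoChart L) '' (Set.univ ×ˢ (Subtype.val ⁻¹' {v : Edge 3 L → Fin 3 → ℝ | ‖linkEmbed L v‖ < ρ})) := by
    intro U hU
    obtain ⟨hUeq, -, hcap, hsq⟩ := mem_orthoTubeSet_of_near_one (L := L) hδ0.le hδ50 hU
    set v : Edge 3 L → Fin 3 → ℝ := fun e => vecPart (U e * (polarMean L e.2 U)⁻¹) with hv
    have hnorm : ‖linkEmbed L v‖ < ρ := by
      have h2 : ‖linkEmbed L v‖ ^ 2 < ρ ^ 2 := by
        rw [norm_linkEmbed_sq]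
        calc ∑ e : Edge 3 L, ∑ a : Fin 3, v e a ^ 2 ≤ ∑ _e : Edge 3 L, 10 * δ := Finset.sum_le_sum fun e _ => hsq e
          _ = Fintype.card (Edge 3 L) * (10 * δ) := by rw [Finset.sum_const, Finset.card_univ, nsmul_eq_mul]
          _ ≤ Fintype.card (Edge 3 L) * (10 * (ρ ^ 2 / (20 * Fintype.card (Edge 3 L)))) := by gcongr
          _ = ρ ^ 2 / 2 := by field_simp; ring
          _ < ρ ^ 2 := by nlinarith [sq_pos_of_pos hρ]
      exact (abs_lt_of_sq_lt_sq' h2 hρ.le).2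
    refine ⟨((slowMean L U)⁻¹, ⟨v, hcap⟩), ⟨Set.mem_univ _, ?_⟩, ?_⟩
    · show ‖linkEmbed L v‖ < ρ
      exact hnorm
    · show orthoChart L ((slowMean L U)⁻¹)⁻¹ ⟨v, hcap⟩ = U
      rw [inv_inv]
      exact hUeq
  have hfloor := configMeasure_real_nearBox_ge (L := L) hδ0 (by linarith)
  rw [measureReal_def, orthoTransverse_apply L hA, ← measureReal_def]
  exact hfloor.trans (measureReal_mono hsub)

/-! ## §4 ★ The inner Gaussian fibre mass -/

/-- ★ **Inner Gaussian fibre mass floor**: for `0 ≤ t`, `0 ≤ b`, `0 < s`, `ρ ≤ R`,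
`∫ 𝟙_{‖x‖≤R}·e^{−q_{t,b}(x)}²·e^{−‖P_Γx‖²/s²} dπ ≥ e^{−(2(96t+b) + 1/s²)ρ²}·π{‖linkEmbed v‖ < ρ}`. [folklore] -/
theorem inner_gauss_mass_ge {t b s ρ R : ℝ} (ht : 0 ≤ t) (hb : 0 ≤ b) (hs : 0 < s) (hρR : ρ ≤ R) :
    Real.exp (-((2 * (96 * t + b) + 1 / s ^ 2) * ρ ^ 2)) * (orthoTransverse L).real {v | ‖linkEmbed L v‖ < ρ} ≤
      ∫ v, {v : Edge 3 L → Fin 3 → ℝ | ‖linkEmbed L v‖ ≤ R}.indicator (fun _ => (1 : ℝ)) v *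
          (Real.exp (-(stiffGaussExp L t b (linkEmbed L v))) ^ 2 * Real.exp (-(‖(gaugeModes L).starProjection (linkEmbed L v)‖ ^ 2 / s ^ 2))) ∂orthoTransverse L := by
  haveI := isFiniteMeasure_orthoTransverse L
  have hB : MeasurableSet {v : Edge 3 L → Fin 3 → ℝ | ‖linkEmbed L v‖ < ρ} := measurableSet_lt ((measurable_linkEmbed L).norm) measurable_const
  set f : (Edge 3 L → Fin 3 → ℝ) → ℝ := fun v => {v : Edge 3 L → Fin 3 → ℝ | ‖linkEmbed L v‖ ≤ R}.indicator (fun _ => (1 : ℝ)) v *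
    (Real.exp (-(stiffGaussExp L t b (linkEmbed L v))) ^ 2 * Real.exp (-(‖(gaugeModes L).starProjection (linkEmbed L v)‖ ^ 2 / s ^ 2))) with hf
  have hf0 : ∀ v, 0 ≤ f v := fun v => by
    rw [hf]; dsimp only
    by_cases h : v ∈ {v : Edge 3 L → Fin 3 → ℝ | ‖linkEmbed L v‖ ≤ R}
    · rw [Set.indicator_of_mem h]; positivity
    · rw [Set.indicator_of_notMem h, zero_mul]
  have hfm : Measurable f := by
    rw [hf]
    refine (measurable_const.indicator (measurableSet_le (measurable_linkEmbed L).norm measurable_const)).mul ?_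
    exact ((((measurable_stiffGaussExp t b).comp (measurable_linkEmbed L)).neg.exp).pow_const 2).mul
      ((((gaugeModes L).starProjection.continuous.measurable.comp (measurable_linkEmbed L)).norm.pow_const 2).div_const _).neg.exp
  have hfb : ∀ v, |f v| ≤ 1 := fun v => by
    rw [abs_of_nonneg (hf0 v), hf]; dsimp only
    by_cases h : v ∈ {v : Edge 3 L → Fin 3 → ℝ | ‖linkEmbed L v‖ ≤ R}
    · rw [Set.indicator_of_mem h, one_mul]
      have h1 : Real.exp (-(stiffGaussExp L t b (linkEmbed L v))) ^ 2 ≤ 1 :=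
        pow_le_one₀ (Real.exp_pos _).le (Real.exp_le_one_iff.mpr (neg_nonpos.mpr (stiffGaussExp_nonneg _ _ _)))
      have h2 : Real.exp (-(‖(gaugeModes L).starProjection (linkEmbed L v)‖ ^ 2 / s ^ 2)) ≤ 1 := Real.exp_le_one_iff.mpr (neg_nonpos.mpr (by positivity))
      calc _ ≤ 1 * 1 := mul_le_mul h1 h2 (Real.exp_pos _).le zero_le_one
        _ = 1 := one_mul _
    · rw [Set.indicator_of_notMem h, zero_mul]; exact zero_le_one
  have hfi : Integrable f (orthoTransverse L) := integrable_of_measurable_abs_le _ hfm hfb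
  -- on the small ball the integrand is `≥ e^{−(2(96t+b)+1/s²)ρ²}`
  have hlow : ∀ v ∈ {v : Edge 3 L → Fin 3 → ℝ | ‖linkEmbed L v‖ < ρ}, Real.exp (-((2 * (96 * t + b) + 1 / s ^ 2) * ρ ^ 2)) ≤ f v := by
    intro v hv
    have hvρ : ‖linkEmbed L v‖ < ρ := hv
    have hvR : v ∈ {v : Edge 3 L → Fin 3 → ℝ | ‖linkEmbed L v‖ ≤ R} := le_trans hvρ.le hρR
    rw [hf]; dsimp only
    rw [Set.indicator_of_mem hvR, one_mul, ← Real.exp_nat_mul, ← Real.exp_add]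
    apply Real.exp_le_exp.2
    have hq := stiffGaussExp_le_mul_norm_sq (L := L) ht hb (linkEmbed L v)
    have hP : ‖(gaugeModes L).starProjection (linkEmbed L v)‖ ≤ ‖linkEmbed L v‖ := Submodule.norm_starProjection_apply_le _ _
    have hx2 : ‖linkEmbed L v‖ ^ 2 ≤ ρ ^ 2 := pow_le_pow_left₀ (norm_nonneg _) hvρ.le 2
    have hP2 : ‖(gaugeModes L).starProjection (linkEmbed L v)‖ ^ 2 ≤ ρ ^ 2 := (pow_le_pow_left₀ (norm_nonneg _) hP 2).trans hx2
    have h96 : 0 ≤ 96 * t + b := by positivity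
    have hq' : stiffGaussExp L t b (linkEmbed L v) ≤ (96 * t + b) * ρ ^ 2 := hq.trans (mul_le_mul_of_nonneg_left hx2 h96)
    have hs2 : 0 < s ^ 2 := by positivity
    have hdiv : ‖(gaugeModes L).starProjection (linkEmbed L v)‖ ^ 2 / s ^ 2 ≤ ρ ^ 2 / s ^ 2 := div_le_div_of_nonneg_right hP2 hs2.le
    push_cast
    have e : -((2 * (96 * t + b) + 1 / s ^ 2) * ρ ^ 2) = 2 * (-((96 * t + b) * ρ ^ 2)) + (-(ρ ^ 2 / s ^ 2)) := by ring
    rw [e]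
    linarith
  calc Real.exp (-((2 * (96 * t + b) + 1 / s ^ 2) * ρ ^ 2)) * (orthoTransverse L).real {v | ‖linkEmbed L v‖ < ρ}
      = ∫ v in {v : Edge 3 L → Fin 3 → ℝ | ‖linkEmbed L v‖ < ρ}, Real.exp (-((2 * (96 * t + b) + 1 / s ^ 2) * ρ ^ 2)) ∂orthoTransverse L := by
        rw [setIntegral_const, smul_eq_mul, mul_comm, measureReal_def]
    _ ≤ ∫ v in {v : Edge 3 L → Fin 3 → ℝ | ‖linkEmbed L v‖ < ρ}, f v ∂orthoTransverse L :=
        setIntegral_mono_on (integrable_const _).integrableOn hfi.integrableOn hB hlow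
    _ ≤ ∫ v, f v ∂orthoTransverse L := setIntegral_le_integral hfi (ae_of_all _ hf0)

end Summit.QuantumFields.YangMills.Theorems.FemtoTransferGap.TwoLattice.ConstTube

end
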